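import Summits.AtomisticToContinuum.Crystallization.Theses.PalmUnimodularRigidity
import Literature.Probability.Process.PointStationaryLaw
import Literature.MathematicalPhysics.StatisticalMechanics.RootEnergy

/-!
# Crux `MinimiserShells` (stmt-AtomisticToContinuum-9225) — ideator 2, round 1: first lemmas

Two levers, typed over existing declarations (no new axioms, no sorry):

* **Card `cluster-defect-pricing`** — boundary-free finite pricing
  `ClusterDefectPricing` (CDP): `𝓔_N(x) ≥ N·e* + c·#{i : shell of i is bad}` for EVERY finite
  configuration; law-level form `DefectPricingInLaw`; `minimiserShells_of_defectPricingInLaw`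
  (PROVED) and the transfer stub `GridTransfer : CDP → DefectPricingInLaw` (random-grid mass
  transport of item 9229 with `E(n) ≥ n e*` replaced by CDP).
* **Card `two-cell-alphabet-star`** — empty-sphere (Delaunay) cells at the root drawn from the
  alphabet {regular `a`-tetrahedron, `a`-quarter-octahedron} force the FCC/HCP shell:
  `AlphabetStarRigidity` (pure geometry, single site, tolerance below the decahedral threshold),
  `AlphabetSelection` (the energy core, a.s.), and `minimiserShells_of_alphabet` (PROVED glue).
-/

noncomputable section

open scoped BigOperators ENNReal Classical
open MeasureTheory Set Filter Metric
open Literature.MathematicalPhysics.StatisticalMechanics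
open Literature.Geometry.DiscreteGeometry
open Literature.Probability.Process

namespace Summit.AtomisticToContinuum.Crystallization.Cruxes.MinimiserShells.IdeatorTwo

local notation "E3" => EuclideanSpace ℝ (Fin 3)

/-! ## Common objects -/

/-- `e* = ⨅` over periodic configurations of the Lennard-Jones energy per particle. -/
def eStar : ℝ := ⨅ Q : PeriodicConfiguration 3, Q.energyPerParticle lennardJones

/-- The crux's conclusion for one rooted configuration `μ` (tolerance `a/100`), verbatim. -/
def GoodShell (μ : Measure E3) : Prop :=
  ∃ a : ℝ, 9 / 10 ≤ a ∧ a ≤ 1 ∧ ∃ T : Finset E3,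
    (↑T : Set E3) = {y : E3 | μ {y} ≠ 0 ∧ y ≠ 0 ∧ ‖y‖ ≤ 5 / 4 * a} ∧
    (ShellCloseTo (a / 100) T (Finset.image (fun v : E3 => a • v) fccKissingPattern) ∨
      ShellCloseTo (a / 100) T (Finset.image (fun v : E3 => a • v) hcpKissingPattern))

/-- Monotonicity of `ShellCloseTo` in the tolerance (from `EtaMatched.mono`). -/
theorem shellCloseTo_mono {η η' : ℝ} (hη : η ≤ η') {T P : Finset E3} (h : ShellCloseTo η T P) :
    ShellCloseTo η' T P := by
  obtain ⟨A, hA⟩ := h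
  exact ⟨A, hA.mono hη⟩

/-- Folded form of the crux: frame = probability law, a.s. rooted `δ`-hard-core,
point-stationary (Mecke), minimising `E_P[rootEnergy] ≤ e*`; conclusion a.s. `GoodShell`. -/
theorem minimiserShells_iff :
    Theses.PalmUnimodularRigidity.MinimiserShells ↔
      ∀ δ : ℝ, 0 < δ → ∀ P : Measure (Measure E3), IsProbabilityMeasure P →
        (∀ᵐ μ ∂P, IsRootedHardCore δ μ) → IsPointStationaryLaw P →
        ∫ μ, rootEnergy lennardJones μ ∂P ≤ eStar → ∀ᵐ μ ∂P, GoodShell μ :=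
  Iff.rfl

/-! ## Card `cluster-defect-pricing` -/

/-- A finite configuration `x` seen from particle `i`: the counting measure of `{x_k − x_i}`. -/
def rootedAt {N : ℕ} (x : Fin N → E3) (i : Fin N) : Measure E3 :=
  Measure.count.restrict (Set.range fun k => x k - x i)

/-- Number of particles of `x` whose first shell is NOT `(a/100)`-FCC/HCP for any admissible
scale `a` (surface particles — fewer than twelve neighbours — count as bad). -/
def badCount {N : ℕ} (x : Fin N → E3) : ℕ :=
  (Finset.univ.filter fun i : Fin N => ¬ GoodShell (rootedAt x i)).card

/-- **CDP — cluster defect pricing (boundary-free, full Lennard-Jones).** There is `c > 0` such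
that EVERY finite configuration of distinct points satisfies
`𝓔_N(x) ≥ N·e* + c·#bad(x)`. No boundary term: a free surface only raises the energy above the
bulk rate `e*` (missing bonds and missing attractive tail), and surface particles are counted as
bad. Contains `E(N) ≥ N e*` (take `c·#bad ≥ 0`). -/
def ClusterDefectPricing : Prop :=
  ∃ c : ℝ, 0 < c ∧ ∀ (N : ℕ) (x : Fin N → E3), Function.Injective x →
    (N : ℝ) * eStar + c * (badCount x : ℝ) ≤ interactionEnergy lennardJones x

/-- CDP contains the sharp finite lower bound `N·e* ≤ 𝓔_N(x)`. -/
theorem energy_lb_of_clusterDefectPricing (h : ClusterDefectPricing) {N : ℕ} (x : Fin N → E3)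
    (hx : Function.Injective x) : (N : ℝ) * eStar ≤ interactionEnergy lennardJones x := by
  obtain ⟨c, hc, h⟩ := h
  have := h N x hx
  have h0 : 0 ≤ c * (badCount x : ℝ) := by positivity
  linarith

/-- **Law-level defect pricing**: for every point-stationary rooted hard-core probability law,
`e* + c·P(bad root shell) ≤ E_P[rootEnergy]`. -/
def DefectPricingInLaw : Prop :=
  ∃ c : ℝ, 0 < c ∧ ∀ δ : ℝ, 0 < δ → ∀ P : Measure (Measure E3), IsProbabilityMeasure P →
    (∀ᵐ μ ∂P, IsRootedHardCore δ μ) → IsPointStationaryLaw P →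
    eStar + c * (P {μ | ¬ GoodShell μ}).toReal ≤ ∫ μ, rootEnergy lennardJones μ ∂P

/-- **The transfer stub (M-sized): CDP ⇒ law-level pricing**, by the random-grid mass transport
of item 9229 (`UnimodularEnergyLowerBound`): adjoin a uniform phase of the grid `Lℤ³`, send
`h(x) − e* − c·1[bad x]` from every point to the points of its cell; CDP applied to the cell's
points as a free cluster bounds the mass received at the root below by `−C·n_∂/n`, whose
expectation is `O(1/L)` by a second transport; let `L → ∞`. -/
def GridTransfer : Prop := ClusterDefectPricing → DefectPricingInLaw

/-- PROVED glue: law-level pricing closes the crux (minimising ⇒ `P(bad) = 0` ⇒ a.s. good). -/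
theorem minimiserShells_of_defectPricingInLaw (h : DefectPricingInLaw) :
    Theses.PalmUnimodularRigidity.MinimiserShells := by
  rw [minimiserShells_iff]
  obtain ⟨c, hc, h⟩ := h
  intro δ hδ P hP hcore hstat hmin
  have h1 := h δ hδ P hP hcore hstat
  have ht : (P {μ | ¬ GoodShell μ}).toReal ≤ 0 := by
    by_contra hlt
    have := mul_pos hc (not_le.1 hlt)
    linarith
  have ht0 : (P {μ | ¬ GoodShell μ}).toReal = 0 := le_antisymm ht ENNReal.toReal_nonneg
  have hz : P {μ | ¬ GoodShell μ} = 0 := by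
    rcases (ENNReal.toReal_eq_zero_iff _).1 ht0 with h0 | htop
    · exact h0
    · exact absurd htop (measure_ne_top P _)
  exact ae_iff.2 hz

/-- Hence the line: `GridTransfer` (stub) and `ClusterDefectPricing` (the finite core) give the
crux by name. -/
theorem minimiserShells_of_CDP (hT : GridTransfer) (hC : ClusterDefectPricing) :
    Theses.PalmUnimodularRigidity.MinimiserShells :=
  minimiserShells_of_defectPricingInLaw (hT hC)

/-! ## Card `two-cell-alphabet-star` -/

/-- `{0, p, q, r} ⊆ S` spans an **empty-sphere (Delaunay) tetrahedron at the root**: affinely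
independent, and no point of `S` lies strictly inside its circumball (Mathlib
`Affine.Simplex.circumcenter/circumradius`). Degenerate (cospherical) cells contribute all their
non-degenerate 4-subsets, e.g. a regular octahedron contributes its quarters. -/
def IsEmptySphereTet (S : Set E3) (p q r : E3) : Prop :=
  p ∈ S ∧ q ∈ S ∧ r ∈ S ∧ ∃ h : AffineIndependent ℝ ![(0 : E3), p, q, r],
    ∀ z ∈ S, (⟨![(0 : E3), p, q, r], h⟩ : Affine.Simplex ℝ E3 3).circumradius ≤
      dist z (⟨![(0 : E3), p, q, r], h⟩ : Affine.Simplex ℝ E3 3).circumcenter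

/-- **The two-letter cell alphabet at scale `a`, tolerance `η`** for a tetrahedron `(0, p, q, r)`:
either all six edges are within `η·a` of `a` (regular `a`-tetrahedron, letter T), or five are and
the sixth is within `η·a` of `√2·a` (a quarter of the regular `a`-octahedron, letter Q — the
Delaunay pieces of the octahedral hole). -/
def IsAlphabetTet (η a : ℝ) (p q r : E3) : Prop :=
  let e : Fin 6 → ℝ := ![‖p‖, ‖q‖, ‖r‖, dist p q, dist q r, dist p r]
  (∀ i, |e i - a| ≤ η * a) ∨
    (∃ j, |e j - Real.sqrt 2 * a| ≤ η * a ∧ ∀ i, i ≠ j → |e i - a| ≤ η * a)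

/-- The root of `S` has an **alphabet star** at scale `a`, tolerance `η`: `0 ∈ S`, local
finiteness, the root is interior (its Delaunay star covers all directions), local separation
`(1 − η)a` inside radius `3a/2`, and EVERY empty-sphere tetrahedron at the root is a letter. -/
def AlphabetStarAt (η a : ℝ) (S : Set E3) : Prop :=
  (0 : E3) ∈ S ∧ (S ∩ closedBall (0 : E3) (2 * a)).Finite ∧
    (0 : E3) ∈ interior (convexHull ℝ (S ∩ closedBall (0 : E3) (2 * a))) ∧
    (∀ x ∈ S, ∀ y ∈ S, x ≠ y → ‖x‖ ≤ 3 / 2 * a → ‖y‖ ≤ 3 / 2 * a → (1 - η) * a ≤ dist x y) ∧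
    ∀ p q r : E3, IsEmptySphereTet S p q r → IsAlphabetTet η a p q r

/-- **K2 — alphabet-star rigidity (pure geometry, ONE site, no potential, no measure).** For
tolerances `η ≤ η₀` below the decahedral threshold (`5·Kη < 2π − 5·arccos(1/3) ≈ 7.36°`;
`η₀ = 1/400` is the proposal) an alphabet star at the root forces: exactly twelve points within
`5a/4`, `(C·η·a)`-matched after a rotation to the `a`-scaled FCC or HCP kissing pattern.
Mechanism: around each root edge the dihedral angles of the letters (70.53° for T; 54.74°,
109.47°, 90° for Q) must sum to `2π`; the only solutions have exactly two T's per unit edge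
(the five-T ring misses by the frustration gap `frustrationGap_bounds`), the solid angles then
force 8 T + 6 octahedra (`octahedronDensity`/`tetDihedralAngle` constants in tree), the link is a
sphere tiling by 8 triangles and 6 squares with two of each at every vertex — cuboctahedron or
anticuboctahedron (Hales 2012 Lemma 9 / Johnson–Zalgaller; FTTT 2013 equality case) — and
`KissingRigidity` upgrades combinatorics to `C·η`-closeness. -/
def AlphabetStarRigidity (η₀ C : ℝ) : Prop :=
  ∀ η : ℝ, 0 < η → η ≤ η₀ → ∀ a : ℝ, 9 / 10 ≤ a → a ≤ 1 → ∀ S : Set E3, AlphabetStarAt η a S →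
    ∃ T : Finset E3, (↑T : Set E3) = {y : E3 | y ∈ S ∧ y ≠ 0 ∧ ‖y‖ ≤ 5 / 4 * a} ∧
      (ShellCloseTo (C * η * a) T (Finset.image (fun v : E3 => a • v) fccKissingPattern) ∨
        ShellCloseTo (C * η * a) T (Finset.image (fun v : E3 => a • v) hcpKissingPattern))

/-- **K1 — alphabet selection (the energy core, measure level).** Minimising point-stationary
rooted hard-core laws are a.s. alphabet-starred at the root, at some own scale `a ∈ [9/10, 1]`
and the fixed tolerance `η` (proposal `η = 1/400`; relaxed hcp has cell distortion `≈ 4e-4`). -/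
def AlphabetSelection (η : ℝ) : Prop :=
  ∀ δ : ℝ, 0 < δ → ∀ P : Measure (Measure E3), IsProbabilityMeasure P →
    (∀ᵐ μ ∂P, IsRootedHardCore δ μ) → IsPointStationaryLaw P →
    ∫ μ, rootEnergy lennardJones μ ∂P ≤ eStar →
    ∀ᵐ μ ∂P, ∃ a : ℝ, 9 / 10 ≤ a ∧ a ≤ 1 ∧ AlphabetStarAt η a {y : E3 | μ {y} ≠ 0}

/-- PROVED glue: K2 at `(η₀, C)` and K1 at a tolerance `η₁ ≤ η₀` with `C·η₁ ≤ 1/100` give the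
crux by name (e.g. `η₀ = η₁ = 1/400`, `C = 4`). -/
theorem minimiserShells_of_alphabet {η₀ C η₁ : ℝ} (hR : AlphabetStarRigidity η₀ C)
    (hη₁ : 0 < η₁) (hη₁₀ : η₁ ≤ η₀) (hCη : C * η₁ ≤ 1 / 100)
    (hS : AlphabetSelection η₁) : Theses.PalmUnimodularRigidity.MinimiserShells := by
  rw [minimiserShells_iff]
  intro δ hδ P hP hcore hstat hmin
  filter_upwards [hS δ hδ P hP hcore hstat hmin] with μ hμ
  obtain ⟨a, ha1, ha2, hstar⟩ := hμ
  obtain ⟨T, hT, hclose⟩ := hR η₁ hη₁ hη₁₀ a ha1 ha2 _ hstar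
  refine ⟨a, ha1, ha2, T, ?_, ?_⟩
  · rw [hT]
    ext y
    exact Iff.rfl
  · have ha0 : 0 ≤ a := by linarith
    have hle : C * η₁ * a ≤ a / 100 := by nlinarith
    exact hclose.imp (shellCloseTo_mono hle) (shellCloseTo_mono hle)

end Summit.AtomisticToContinuum.Crystallization.Cruxes.MinimiserShells.IdeatorTwo

end
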